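import Summits.Ventures.CertifiedManyBodySolver.Downfold.EmeryVanHoveSubBox
import Summits.Ventures.CertifiedManyBodySolver.Downfold.EmeryVanHoveTableA
import Summits.Ventures.CertifiedManyBodySolver.Downfold.EmeryVanHoveTableD
import Summits.Ventures.CertifiedManyBodySolver.Downfold.EmeryFermiFillingNCCO
import HarnessLib

/-!
# Nd₂₋ₓCeₓCuO₄ x = 0.15 (box Nd2CuO4-NCCO, (K) source rows; ELECTRON-doped: n_H = 0.85 ⇒ abFilling = 0.575 > ½): the CERTIFIED van Hove (Lifshitz) hole doping of the σ three-band model on the typed 3BE one-body box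
# — `x_VH ∈ [0.1751, 0.3252]`

Venture CertifiedManyBodySolver, cell `pub/hubbard-downfold` (stage S1, HUMAN RULINGS D-0096/D-0098: the three-band → one-band reduction error is
carried explicitly), seat hubbard-downfold-mod-4 (technique B = band level); namespace `Summit.Ventures.CertifiedManyBodySolver.Downfold.Emery`.
Everything PROVED; numerics decided by the kernel (ONE `vhBoxCheck` + two entries of the certified table of `Ψ`, `EmeryVanHoveTableA/D`).

DEVICE (`EmeryVanHoveFactorisation` / `EmeryVanHoveSubBox`): the σ-model van Hove hole doping `x_VH = 1 − 2·abFilling(ε_VH)` (the hole count per Cu,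
relative to the half-filled antibonding band, at which the Fermi level reaches the saddle point `ε_AB(X)`) FACTORISES as `x_VH = 1 − 2Ψ(q)`,
`q = u(1 + u)`, **`u = 2(t_pp + t_pp′)/(Δ_pd + ε_VH)`**, with `Ψ` universal and antitone; `u` is monotone in each band parameter, so the window
below is CORNER-EXACT up to the table resolution (±0.005 per side, `K = 384` grid).

THE STATEMENT (`nCCOBox_xVH`, typed words `emeryBoxNCCOK26Src`). For every parameter vector of the box
Δ_pd [1, 2.05] × t_pd [0.9, 1.29] × t_pp [0.52, 0.72] × t_pp′ [0.02, 0.02] (one-body rows of Nd₂₋ₓCeₓCuO₄ x = 0.15 (box Nd2CuO4-NCCO, (K) source rows; ELECTRON-doped: n_H = 0.85 ⇒ abFilling = 0.575 > ½)):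
**ε_VH ∈ [1.026, 2.096]** (eV above ε_d), **Δ_pd + ε_VH ∈ [2.339, 3.776]**, **q ∈ [0.3677, 1.0330]**
(i.e. the σ Fermi-surface `−t′/t` AT THE SADDLE ENERGY `ρ = q/(1 + 2q) ∈ [0.2119, 0.3369]`), `x_VH = 1 − 2Ψ(q)`, and
**`x_VH ∈ [0.1751, 0.3252]`** (table entries `Ψ(73/200) ≤ 60815/147456`, `Ψ(207/200) ≥ 49753/147456`).
Float truth at the two extreme corners (not a theorem): x_VH ∈ [0.1813, 0.3197].

READING (the box file's business; comparators are [float]): see the box file addendum / router/EMERY-FS-WINDOWS.md §x_VH.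
WHAT THIS IS NOT: not a statement that the material's parameters ARE in the box (SCREENING-GRADE provenance); `U = 0` band kinematics of the σ
d–p_x–p_y(+t_pp, t_pp′) model; the identification of a material's LIFSHITZ transition with this one-body crossing is the consumer's modelling claim
(correlations and the axial / longer-range one-body channels both move it); no phase sentence. Sources: [HybertsenSchluterChristensen1989, Eq. (1)];
[AndersenEtAl1995, §6]; [PavariniEtAl2001, Eq. (1)].
-/

noncomputable section

namespace Summit.Ventures.CertifiedManyBodySolver.Downfold.Emery

open Real Set
open Summit.Ventures.CertifiedManyBodySolver.Downfold

/-- **Nd₂₋ₓCeₓCuO₄ x = 0.15 (box Nd2CuO4-NCCO, (K) source rows; ELECTRON-doped: n_H = 0.85 ⇒ abFilling = 0.575 > ½) — raw-coordinate van Hove certificate**: on Δ_pd [1, 2.05] × t_pd [0.9, 1.29] × t_pp [0.52, 0.72] × t_pp′ [0.02, 0.02]: `ε_VH ∈ [1.026, 2.096]`,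
`q ∈ [0.3677, 1.0330]`, `x_VH = 1 − 2Ψ(q)` and `x_VH ∈ [0.1751, 0.3252]`. [folklore] -/
theorem nCCOBox_xVH {Δ tpd tpp c : ℝ} (hΔ : Δ ∈ Set.Icc (1 : ℝ) (41 / 20 : ℝ))
    (ha : tpd ∈ Set.Icc (9 / 10 : ℝ) (129 / 100 : ℝ)) (hb : tpp ∈ Set.Icc (13 / 25 : ℝ) (18 / 25 : ℝ))
    (hc : c ∈ Set.Icc (1 / 50 : ℝ) (1 / 50 : ℝ)) :
    vhEnergy Δ tpd c ∈ Set.Icc (1283 / 1250 : ℝ) (262 / 125 : ℝ) ∧ vhRatio Δ tpd tpp c ∈ Set.Icc (3677 / 10000 : ℝ) (1033 / 1000 : ℝ) ∧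
      xVH Δ tpd tpp c = 1 - 2 * vhFrac (vhRatio Δ tpd tpp c) ∧ xVH Δ tpd tpp c ∈ Set.Icc (12913 / 73728 : ℝ) (23975 / 73728 : ℝ) := by
  have h := xVH_window_of_vhBoxCheck
    (Δ₁ := (1 : ℚ)) (Δ₂ := ((41 : ℚ) / 20)) (a₁ := ((9 : ℚ) / 10)) (a₂ := ((129 : ℚ) / 100)) (b₁ := ((13 : ℚ) / 25)) (b₂ := ((18 : ℚ) / 25))
    (c₁ := ((1 : ℚ) / 50)) (c₂ := ((1 : ℚ) / 50)) (v₁ := ((1283 : ℚ) / 1250)) (v₂ := ((262 : ℚ) / 125)) (e := ((837 : ℚ) / 625)) (E := ((8631 : ℚ) / 5000))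
    (q₁ := ((3677 : ℚ) / 10000)) (q₂ := ((1033 : ℚ) / 1000)) (by decide +kernel)
    (Δ := Δ) (tpd := tpd) (tpp := tpp) (c := c) (by simpa using hΔ) (by simpa using ha) (by simpa using hb) (by simpa using hc)
  obtain ⟨hv, -, hq, -, heq, hwin⟩ := h
  push_cast at hv hq hwin
  have hx := xVH_window_of_table hwin (qa := (73 / 200 : ℝ)) (qb := (207 / 200 : ℝ)) (by norm_num) (by norm_num) vhFrac_73_200.2 vhFrac_207_200.1
  exact ⟨⟨by linarith [hv.1], by linarith [hv.2]⟩, ⟨by linarith [hq.1], by linarith [hq.2]⟩, heq,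
    ⟨by linarith [hx.1], by linarith [hx.2]⟩⟩

/-- **THE WORD ON THE TYPED BOX `emeryBoxNCCOK26Src`**: at every parameter vector the σ three-band van Hove (Lifshitz) hole doping lies in
`[0.1751, 0.3252]` (holes per Cu relative to the half-filled antibonding band). [cite: HybertsenSchluterChristensen1989, Eq. (1) (three-band d–p model)] -/
theorem emeryBoxNCCOK26Src_xVH_window :
    HoldsOn (fun p : EmeryCoord → ℝ =>
      xVH (p .DeltaPd) (p .tpd) (p .tpp) (p .tppP) ∈ Set.Icc (12913 / 73728 : ℝ) (23975 / 73728 : ℝ)) emeryBoxNCCOK26Src := by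
  intro p hp
  obtain ⟨hΔ, ha, hb, hc, -⟩ := emeryBoxNCCOK26Src_mem_rows hp
  exact (nCCOBox_xVH hΔ ha hb hc).2.2.2

/-- On `emeryBoxNCCOK26Src`: the saddle energy `ε_VH ∈ [1.026, 2.096]` and the ratio `q ∈ [0.3677, 1.0330]` (`−t′/t` at the saddle energy
`∈ [0.2119, 0.3369]`). [folklore] -/
theorem emeryBoxNCCOK26Src_vhEnergy_vhRatio_window :
    HoldsOn (fun p : EmeryCoord → ℝ =>
      vhEnergy (p .DeltaPd) (p .tpd) (p .tppP) ∈ Set.Icc (1283 / 1250 : ℝ) (262 / 125 : ℝ) ∧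
      vhRatio (p .DeltaPd) (p .tpd) (p .tpp) (p .tppP) ∈ Set.Icc (3677 / 10000 : ℝ) (1033 / 1000 : ℝ)) emeryBoxNCCOK26Src := by
  intro p hp
  obtain ⟨hΔ, ha, hb, hc, -⟩ := emeryBoxNCCOK26Src_mem_rows hp
  exact (nCCOBox_xVH hΔ ha hb hc)|> fun h => ⟨h.1, h.2.1⟩

end Summit.Ventures.CertifiedManyBodySolver.Downfold.Emery
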